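import Summits.HodgeConjecture.CorCM.GaloisIndexTwoDoubledTypes
import HarnessLib

/-!
# Two PERIODIC sheets: an arithmetic-free degeneracy criterion for the index-two setting — including the HARD side `c ∈ ⟨x²⟩`

COR-CM (cell `pub-hodgecm2`), binder seat b04 (gen 30), count-neutral own lane «Galois-CM-type classification» (which Galois CM
fields `(G, c)` have ALL primitive CM types nondegenerate = GOOD, vs. a primitive degenerate type = BAD).  KERNEL ONLY: theorems;
no definition, no named fact, no `sorry`.  `HC_CM` is neither used nor claimed.

SETTING (gen 28 `CorCM/TwoSheetDegenerate`).  `G₀ = i(A) ⊔ i(A)x`, `A` abelian of index two, `θ = conj_x` on `A`, `x² = i(q)`,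
complex conjugation `c ∈ A`.  A CM type read on `G₀` is `T = i(S₀) ⊔ i(S₁)x` with two SHEETS `S₀, S₁ ⊂ A` (CM halves for `c`),
and `T` is DEGENERATE as soon as ONE odd character `χ` (`χ(c) = −1`) has a singular block
`Ŝ₀(χ)Ŝ₀(χθ) − χ(q)·Ŝ₁(χ)Ŝ₁(χθ) = 0` (`TwoSheet.exists_annihilator_of_det_eq_zero`).  The doubled types of
`CorCM/GaloisSplitInvolutionTypes` ∕ `CorCM/GaloisIndexTwoDoubledTypes` (`S₀ = S₁`) kill the block through the factor `1 − χ(q)`,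
which needs `c ∉ ⟨q⟩` — the EASY side.  THIS FILE kills it through BOTH FOURIER COEFFICIENTS AT ONCE, `Ŝ₀(χ) = Ŝ₁(χ) = 0`, which
is blind to `χ(q)` and therefore works on the HARD side `c ∈ ⟨q⟩` (dicyclic-type groups, where the block is a sum of two norms
and no residue obstruction can help) as well.  Vanishing is forced by PERIODICITY: if `S_j` is invariant under translation by
`u_j` and `χ(u_j) ≠ 1` then `Ŝ_j(χ) = χ(u_j)Ŝ_j(χ) = 0` (§1 `sum_character_eq_zero_of_periodic`).  Two sheets periodic under
DIFFERENT elements can still be jointly primitive (§1 `twoSheet_leftStabiliser`: no common period `a ≠ 1` of `S₀, S₁`, and no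
`a` with `a·θ(S₀) = S₁ ∧ a q·θ(S₁) = S₀`).

THEOREM (§2 **`exists_simple_degenerate_of_periodic_sheets`**).  `K` Galois CM, `e : Gal(K/ℚ) ≃* G₀ ⊇ i(A)` of index two as
above, complex conjugation `e(c̄) = i(c)`; CM halves `S₀, S₁` of `(A, c)` with `u₀ S₀ = S₀`, `u₁ S₁ = S₁`, an odd character `χ`
with `χ(u₀) ≠ 1 ≠ χ(u₁)`, and the two joint-primitivity conditions ⟹ `K` is BAD: a PRIMITIVE DEGENERATE CM type, realised by
a SIMPLE abelian variety of dimension `|G₀|/2` with CM by `K` carrying a rational `(p,p)` class outside the divisor ring on some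
power.  No hypothesis on `q`: `c² = 1`, `θ c = c` are read off `Gal(K/ℚ)`.

RECIPE.  Subgroups `U₀, U₁ ≤ A` with `c ∉ U_j`, `U₀ ∩ U₁ = 1`, `θ(U₀) ≠ U₁`, pull-backs `S_j` of aperiodic halves of `A/U_j`, and an
odd character non-trivial on both: e.g. **`Dic_m × C₂` (`m` odd, `c = aᵐ`; `U₀ = ⟨a²⟩ × C₂`, `U₁ = ⟨aᵐ t⟩`) — the last open
`H = C₂` real factor of a dicyclic group, `CorCM/GaloisDicyclicOddTimesTwoDegenerate`**; `Dic_{pq}` (`U₀ = C_p`, `U₁ = C_q`,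
recovering gen 20); generalised dicyclic `Dic(ℤ/4 × ℤ/4)`.  It correctly FAILS (no admissible `χ`) for the GOOD hard-side groups
`Q₈ × C₂`, `Q₈ × C_p`, `C_p ⋊ C₈`, `Dic_p`, `D₁₆` — there every `c`-avoiding subgroup pair is annihilated by the oddness of `χ`.

## References

* [Kubota1965] T. Kubota, *On the field extension by complex multiplication*, Trans. AMS 118 (1965), §2, §4 Lemma 2.
* [Dodson1987] B. Dodson, *On the Mumford–Tate group of an abelian variety with complex multiplication*, J. Algebra 111
  (1987), §1.1.
* [Shimura1998] G. Shimura, *Abelian Varieties with Complex Multiplication and Modular Functions*, §6.2 Thm. 3, §8.2 Prop. 26.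
* [Gordon1999HodgeAVSurvey] B. B. Gordon, *A survey of the Hodge conjecture for abelian varieties*, Thm. 6.4, §9.3.
-/

noncomputable section

open CategoryTheory CategoryTheory.Limits NumberField
open scoped BigOperators

namespace Summit.HodgeConjecture.CorCM.SplitInvolution

open Literature.NumberTheory.ComplexMultiplication
open Literature.AlgebraicGeometry.Motives (AbelianVariety CMType)
open Literature.AlgebraicGeometry.HodgeTheory
open Literature.AlgebraicGeometry.ComplexMultiplication (IsCMTypeRealisation)
open Literature.AlgebraicGeometry.Pohlmann1968
open Literature.Barriers.HodgeConjecture (divisorClassesSpan)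
open Summit.HodgeConjecture.CorCM.GaloisRank
open Summit.HodgeConjecture.CorCM.AbelianSixteen (exists_simple_realisation_of_isPrimitive)

/-! ## §1 Two sheets on the model: membership, CM, left stabiliser, periodic vanishing, annihilator -/

section Model

variable {G₀ : Type*} [Group G₀] [DecidableEq G₀]
variable {A : Type*} [CommGroup A] [Fintype A] [DecidableEq A]

omit [Fintype A] [DecidableEq A] in
/-- Membership in the two-sheet set `T = i(S₀) ⊔ i(S₁)x`: `i u ∈ T ↔ u ∈ S₀` and `i(u) x ∈ T ↔ u ∈ S₁`. [folklore] -/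
theorem twoSheet_mem_iff (i : A →* G₀) (hi : Function.Injective i) (x : G₀) (hx : ∀ u, i u ≠ x) (S₀ S₁ : Finset A) (u : A) :
    (i u ∈ S₀.image i ∪ S₁.image (fun s => i s * x) ↔ u ∈ S₀) ∧
      (i u * x ∈ S₀.image i ∪ S₁.image (fun s => i s * x) ↔ u ∈ S₁) := by
  have hx' : ∀ u v : A, i u ≠ i v * x := fun u v h => hx (v⁻¹ * u) (by rw [map_mul, map_inv, h]; group)
  constructor
  · rw [Finset.mem_union, Finset.mem_image, Finset.mem_image]
    constructor
    · rintro (⟨s, hs, hsu⟩ | ⟨s, -, hsu⟩)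
      · rwa [← hi hsu]
      · exact absurd hsu.symm (hx' u s)
    · exact fun hu => Or.inl ⟨u, hu, rfl⟩
  · rw [Finset.mem_union, Finset.mem_image, Finset.mem_image]
    constructor
    · rintro (⟨s, -, hsu⟩ | ⟨s, hs, hsu⟩)
      · exact absurd hsu (hx' s u)
      · rwa [← hi (mul_right_cancel hsu)]
    · exact fun hu => Or.inr ⟨u, hu, rfl⟩

omit [Fintype A] [DecidableEq A] in
/-- The two-sheet set is a CM set for `i(c)` when both sheets are CM halves for `c`. [folklore] -/
theorem twoSheet_cm (i : A →* G₀) (hi : Function.Injective i) (x : G₀) (hx : ∀ u, i u ≠ x)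
    (hcov : ∀ g : G₀, (∃ u, g = i u) ∨ (∃ u, g = i u * x)) {c : A} (S₀ S₁ : Finset A) (hS₀ : ∀ a, a ∈ S₀ ↔ c * a ∉ S₀)
    (hS₁ : ∀ a, a ∈ S₁ ↔ c * a ∉ S₁) (g : G₀) :
    g ∈ S₀.image i ∪ S₁.image (fun s => i s * x) ↔ i c * g ∉ S₀.image i ∪ S₁.image (fun s => i s * x) := by
  have hmem := twoSheet_mem_iff i hi x hx S₀ S₁
  rcases hcov g with ⟨u, rfl⟩ | ⟨u, rfl⟩
  · rw [(hmem u).1, ← map_mul, (hmem (c * u)).1, hS₀ u]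
  · rw [(hmem u).2, ← mul_assoc, ← map_mul, (hmem (c * u)).2, hS₁ u]

omit [Fintype A] [DecidableEq A] in
/-- **Trivial left stabiliser of a two-sheet set**: no common period `a ≠ 1` of `S₀, S₁` (translations `i(a)`), and no `a` with
`a·θ(S₀) = S₁` and `a q·θ(S₁) = S₀` (the elements `i(a)x`, which swap the sheets: `i(a)x·i(s) = i(aθs)x`,
`i(a)x·i(s)x = i(aθs·q)`). [folklore] -/
theorem twoSheet_leftStabiliser (i : A →* G₀) (hi : Function.Injective i) (x : G₀) (hx : ∀ u, i u ≠ x)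
    (hcov : ∀ g : G₀, (∃ u, g = i u) ∨ (∃ u, g = i u * x)) (θ : A ≃* A) (hθ : ∀ u, x * i u = i (θ u) * x)
    (q : A) (hq : x * x = i q) (S₀ S₁ : Finset A)
    (hper : ∀ a : A, a ≠ 1 → (∃ s, ¬ (s ∈ S₀ ↔ a * s ∈ S₀)) ∨ (∃ s, ¬ (s ∈ S₁ ↔ a * s ∈ S₁)))
    (hrefl : ∀ a : A, (∃ s, ¬ (s ∈ S₀ ↔ a * θ s ∈ S₁)) ∨ (∃ s, ¬ (s ∈ S₁ ↔ a * θ s * q ∈ S₀))) (v : G₀) (hv : v ≠ 1) :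
    ∃ w, ¬ (w ∈ S₀.image i ∪ S₁.image (fun s => i s * x) ↔ v * w ∈ S₀.image i ∪ S₁.image (fun s => i s * x)) := by
  have hmem := twoSheet_mem_iff i hi x hx S₀ S₁
  rcases hcov v with ⟨a, rfl⟩ | ⟨a, rfl⟩
  · have ha : a ≠ 1 := fun h => hv (by rw [h, map_one])
    rcases hper a ha with ⟨s, hs⟩ | ⟨s, hs⟩
    · refine ⟨i s, ?_⟩
      rwa [(hmem s).1, ← map_mul, (hmem (a * s)).1]
    · refine ⟨i s * x, ?_⟩
      rwa [(hmem s).2, ← mul_assoc, ← map_mul, (hmem (a * s)).2]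
  · rcases hrefl a with ⟨s, hs⟩ | ⟨s, hs⟩
    · refine ⟨i s, ?_⟩
      rwa [(hmem s).1, mul_assoc, hθ, ← mul_assoc, ← map_mul, (hmem (a * θ s)).2]
    · refine ⟨i s * x, ?_⟩
      have key : i a * x * (i s * x) = i (a * θ s * q) := by
        rw [map_mul, map_mul, ← hq, mul_assoc (i a) x, ← mul_assoc x, hθ]
        simp only [mul_assoc]
      rwa [(hmem s).2, key, (hmem _).1]

omit [Fintype A] [DecidableEq A] in
/-- **A periodic set has vanishing Fourier coefficient at every character that sees the period**: `uS = S`, `χ(u) ≠ 1` ⟹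
`Σ_{s∈S} χ(s) = 0` (`Ŝ(χ) = χ(u)Ŝ(χ)`). [folklore] -/
theorem sum_character_eq_zero_of_periodic (S : Finset A) (u : A) (hu : ∀ s, s ∈ S ↔ u * s ∈ S)
    (χ : AddChar (Additive A) ℂ) (hχu : χ (Additive.ofMul u) ≠ 1) : ∑ s ∈ S, χ (Additive.ofMul s) = 0 := by
  have h : ∑ s ∈ S, χ (Additive.ofMul (u * s)) = ∑ s ∈ S, χ (Additive.ofMul s) := by
    refine Finset.sum_nbij' (fun s => u * s) (fun s => u⁻¹ * s) (fun s hs => (hu s).1 hs)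
      (fun s hs => (hu (u⁻¹ * s)).2 (by rwa [mul_inv_cancel_left])) (fun s _ => by simp) (fun s _ => by simp)
      (fun s _ => rfl)
  simp only [ofMul_mul, AddChar.map_add_eq_mul] at h
  rw [← Finset.mul_sum] at h
  have h' : (χ (Additive.ofMul u) - 1) * ∑ s ∈ S, χ (Additive.ofMul s) = 0 := by rw [sub_mul, one_mul, h, sub_self]
  exact (mul_eq_zero.1 h').resolve_left (sub_ne_zero.2 hχu)

omit [DecidableEq A] in
/-- **Both sheet coefficients vanish at an odd `χ` ⟹ the block is singular ⟹ a non-zero rational `i(c)`-antisymmetric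
annihilator of all right translates of `T`** (gen 28 `TwoSheet.exists_annihilator_of_det_eq_zero` with
`Δ = 0·Ŝ₀(χθ) − χ(q)·0·Ŝ₁(χθ) = 0` — valid for EVERY `q`). [cite: Kubota1965, §4 Lemma 2] [cite: Dodson1987, §1.1 (p. 50)] -/
theorem exists_annihilator_of_vanishing_sheets [Fintype G₀] (i : A →* G₀) (hi : Function.Injective i) (x : G₀)
    (hx : ∀ u, i u ≠ x) (hcov : ∀ g : G₀, (∃ u, g = i u) ∨ (∃ u, g = i u * x)) (θ : A ≃* A)
    (hθ : ∀ u, x * i u = i (θ u) * x) (q : A) (hq : x * x = i q) {c : A} (hθc : θ c = c) (S₀ S₁ : Finset A)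
    (χ : AddChar (Additive A) ℂ) (hχ : χ (Additive.ofMul c) = -1) (h0 : ∑ s ∈ S₀, χ (Additive.ofMul s) = 0)
    (h1 : ∑ s ∈ S₁, χ (Additive.ofMul s) = 0) :
    ∃ b : G₀ → ℚ, b ≠ 0 ∧ (∀ g, b (i c * g) = -b g) ∧
      ∀ g : G₀, ∑ s ∈ S₀.image i ∪ S₁.image (fun s => i s * x), b (s * g) = 0 := by
  classical
  have hmem := twoSheet_mem_iff i hi x hx S₀ S₁
  exact TwoSheet.exists_annihilator_of_det_eq_zero i hi x hx hcov θ hθ q hq hθc _ S₀ S₁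
    (fun u => ((hmem u).1).symm) (fun u => ((hmem u).2).symm) χ hχ
    (by rw [h0, h1, zero_mul, zero_mul, mul_zero, sub_zero])

end Model

/-! ## §2 The Galois dress: two periodic sheets ⟹ BAD -/

section Field

variable {G₀ : Type*} [Group G₀] [Fintype G₀] [DecidableEq G₀]
variable {A : Type*} [CommGroup A] [Fintype A]
variable {K : Type} [Field K] [NumberField K] [IsCMField K] [IsGalois ℚ K]

/-- **TWO PERIODIC SHEETS ⟹ BAD (any `q`, hard side included).**  `K` a Galois CM field, `e : Gal(K/ℚ) ≃* G₀`, `i : A ↪ G₀`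
abelian of index two (`G₀ = i(A) ⊔ i(A)x`), `x i(u) = i(θ u) x`, `x² = i(q)`, complex conjugation `e(c̄) = i(c)`.  Let `S₀, S₁`
be CM halves of `(A, c)`, `S_j` invariant under translation by `u_j`, and `χ` an ODD character (`χ(c) = −1`) with `χ(u₀) ≠ 1`,
`χ(u₁) ≠ 1`; assume no `a ≠ 1` is a period of both sheets and no `a` has `a·θ(S₀) = S₁ ∧ a q·θ(S₁) = S₀`.  THEN the type
`i(S₀) ⊔ i(S₁)x` is PRIMITIVE and DEGENERATE: `K` carries a SIMPLE abelian variety of dimension `|G₀|/2` with CM by `K` and a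
rational `(p,p)` class outside the divisor ring on some power. [cite: Kubota1965, §2 and §4 Lemma 2]
[cite: Shimura1998, §6.2 Thm. 3 and §8.2 Prop. 26] [cite: Gordon1999HodgeAVSurvey, Thm. 6.4 and §9.3] -/
theorem exists_simple_degenerate_of_periodic_sheets (e : (K ≃ₐ[ℚ] K) ≃* G₀) (i : A →* G₀) (hi : Function.Injective i)
    (x : G₀) (hx : ∀ u, i u ≠ x) (hcov : ∀ g : G₀, (∃ u, g = i u) ∨ (∃ u, g = i u * x)) (θ : A ≃* A)
    (hθ : ∀ u, x * i u = i (θ u) * x) (q : A) (hq : x * x = i q) {c : A}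
    (hc : e ((IsCMField.complexConj K).restrictScalars ℚ) = i c) (S₀ S₁ : Finset A) (hS₀ : ∀ a, a ∈ S₀ ↔ c * a ∉ S₀)
    (hS₁ : ∀ a, a ∈ S₁ ↔ c * a ∉ S₁) (u₀ u₁ : A) (hu₀ : ∀ s, s ∈ S₀ ↔ u₀ * s ∈ S₀) (hu₁ : ∀ s, s ∈ S₁ ↔ u₁ * s ∈ S₁)
    (χ : AddChar (Additive A) ℂ) (hχ : χ (Additive.ofMul c) = -1) (hχ₀ : χ (Additive.ofMul u₀) ≠ 1)
    (hχ₁ : χ (Additive.ofMul u₁) ≠ 1)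
    (hper : ∀ a : A, a ≠ 1 → (∃ s, ¬ (s ∈ S₀ ↔ a * s ∈ S₀)) ∨ (∃ s, ¬ (s ∈ S₁ ↔ a * s ∈ S₁)))
    (hrefl : ∀ a : A, (∃ s, ¬ (s ∈ S₀ ↔ a * θ s ∈ S₁)) ∨ (∃ s, ¬ (s ∈ S₁ ↔ a * θ s * q ∈ S₀))) :
    ∃ (Φ : CMType K) (φ₀ : K →+* ℂ) (X : AbelianVariety ℂ) (ι : 𝓞 K →+* End X)
      (ϑ : K →+* Module.End ℂ (complexBetti X.X 1)),
      IsPrimitive (ℂ ≃+* ℂ) Φ.1 φ₀ ∧ ¬ IsNondegenerate Φ ∧ IsCMTypeRealisation Φ X ι ϑ ∧ X.IsSimple ∧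
      X.dim = Fintype.card G₀ / 2 ∧
      ∃ n p : ℕ, ∃ y : complexBetti (⨁ fun _ : Fin n => X).X (2 * p), IsRationalClass y ∧
        IsOfHodgeType (⨁ fun _ : Fin n => X).dim (⨁ fun _ : Fin n => X).X (2 * p) p p y ∧
        y ∉ divisorClassesSpan (⨁ fun _ : Fin n => X).X (⨁ fun _ : Fin n => X).dim p := by
  classical
  -- `θ c = c`, read off `Gal(K/ℚ)` (complex conjugation is central)
  have hθc : θ c = c := by
    have h1 : i c * x = i (θ c) * x := by rw [← hθ, model_complexConj_comm e hc x]
    exact (hi (mul_right_cancel h1)).symm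
  set T : Finset G₀ := S₀.image i ∪ S₁.image (fun s => i s * x) with hT_def
  have hcm : ∀ g, g ∈ T ↔ i c * g ∉ T := twoSheet_cm i hi x hx hcov S₀ S₁ hS₀ hS₁
  have hprim : ∀ v : G₀, v ≠ 1 → ∃ w, ¬ (w ∈ T ↔ v * w ∈ T) :=
    twoSheet_leftStabiliser i hi x hx hcov θ hθ q hq S₀ S₁ hper hrefl
  obtain ⟨φ₀⟩ := (inferInstance : Nonempty (K →+* ℂ))
  obtain ⟨Φ, hprimΦ, hread⟩ := GaloisTable.exists_isPrimitive_of_tableModel (K := K) (X := G₀)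
    (fun a b => a * b) e.toEquiv (fun _ _ => map_mul e _ _) (i c) hc 1 (map_one e) T hcm hprim φ₀
  have hread' : ∀ y, y ∈ T ↔ embOf φ₀ (e.symm y) ∈ Φ.1 := fun y => hread y
  obtain ⟨b, hb0, hb, hbann⟩ := exists_annihilator_of_vanishing_sheets i hi x hx hcov θ hθ q hq hθc S₀ S₁ χ hχ
    (sum_character_eq_zero_of_periodic S₀ u₀ hu₀ χ hχ₀) (sum_character_eq_zero_of_periodic S₁ u₁ hu₁ χ hχ₁)
  have hdeg : ¬ IsNondegenerate Φ := fun hnd =>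
    hb0 ((isNondegenerate_iff_forall_annihilator e hc Φ φ₀ T hread').1 hnd b hb hbann)
  obtain ⟨X, ι, ϑ, hX, hs, hdim⟩ := exists_simple_realisation_of_isPrimitive Φ φ₀ hprimΦ
  refine ⟨Φ, φ₀, X, ι, ϑ, hprimΦ, hdeg, hX, hs, ?_, exists_exceptional_pow_of_not_isNondegenerate φ₀ hprimΦ hdeg hX⟩
  rw [hdim, ← card_model_eq_finrank e]

end Field

end Summit.HodgeConjecture.CorCM.SplitInvolution

end
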